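import Mathlib
import HarnessLib
import Summits.HubbardSuperconductivity.HubbardSuperconductivity.Theorems.KLProgrammeC4aPPKernelFarSBumpBundle
import Summits.HubbardSuperconductivity.HubbardSuperconductivity.Theorems.KLProgrammeC4aKernelBumpRowsMiddle

/-!
# Route `KLProgramme` — crux C4a, S3 brick (B4) «(U1)-HYBRID», «SWAP-BY-SYMMETRY» kernel side: U7-Middle's FIFTEEN KERNEL ROWS (+ B-1 (vi)'s six) FOR THE BUMPED
# COMPARABLE-LEVELS PIECE `Kr e u := χ(u)·(M_s(e,u)/C)/Cχ` (pen (R529)(A): `U = 2·U_A + U_M`)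

Cell `gate-hubbard-kl`, seat hubbard-kl-k3c3-p1 (g19; row «δμ-flow with klAngularMean constant piece»).  Companion of `…PPKernelFarSBumpBundle` for the comparable piece:
`ppMidKernelS_lawRows` / `midS_hflatB_row` (✓ `…PPKernelMidLawBundle`, `…MidBandRow`) ∘ k3c3-p3 g38's transfer lemmas (✓ `…KernelBumpRows`, ✓ `…KernelBumpRowsWeighted`,
✓ `…KernelBumpRowsMiddle`: `bumpKernel_hcomp/_hKopp/_hflatB`) + this seat's `bumpKernel_hKn1_cutoff` / `bump_ρv_rows`.
* `continuous_ppMidKernelS_value₂` — joint continuity of the VALUE `M_s`;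
* **`ppMidKernelSBump_lawRows`** — the fifteen rows `hKd hK2d hK0 hK0s hK1 hK2 hcomp hKopp hKc hflatB hKn1 hρ0 hρc hρtail hKs1` of `umkLoopCircle_integral_middle_le_canonical`
  for the bumped family: `q_c := 2q′` (`q′ = (2−t₁)/t₁`), `C_t := (C_t⁰/C + Bχ₁·Rχ·(Rχ/lo))/Cχ` (value row on the transition zone from hK0: `Cv := Rχ/lo`), `D_fl := hi/t₁`,
  `A_fl := (W·X_M)/Cχ`, `B_fl := (4(2q′+3/2)(W′+W·Bχ₁) + W·Bχ₁·rχ⁻¹·hi)/Cχ` (band flatness at the modified weight `wt·χ(D−·)`), `ρm := (ρᴹ/C + Bχ₁Rχ²/s)/Cχ`,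
  `Mρ := (Mρᴹ/C + Bχ₁Rχ²hi²/lo³)/Cχ`;
* **`ppMidKernelSBump_firstOrderRows`** — the six rows of B-1 (vi) for the bumped family.
Bump data as in the far bundle: `χ ∈ C²`, `|χ| ≤ 1`, `|χ′| ≤ Bχ₁`, `|χ″| ≤ Bχ₂`, `χ′ = 0` on `|u| ≤ rχ` (`0 < rχ`), `χ′ = χ″ = 0` on `|u| ≥ Rχ`, `lo ≤ hi ≤ Rχ`, `1 + 2Bχ₁Rχ + Bχ₂Rχ² ≤ Cχ`.
Pure real analysis / composition; nothing asserts (C), K3, the window or superconductivity.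
References: BGM 2006 §2.4 (2.36) [cite: BenfattoGiulianiMastropietro2006]; FST II CPAM 51 (1998) §3 [cite: FeldmanSalmhoferTrubowitz1998].
-/

noncomputable section

namespace Summit.HubbardSuperconductivity.HubbardSuperconductivity.Theorems.C4a

set_option linter.dupNamespace false -- summit = problem name (single-conjunct summit), D-0017

open Real Set Filter MeasureTheory intervalIntegral
open scoped Topology Interval
open Literature.MathematicalPhysics.QuantumLattice Literature.Analysis.SpecialFunctions

/-- **Joint continuity of the comparable piece's VALUE** `(e,u) ↦ M_s(e,u)`. [cite: BenfattoGiulianiMastropietro2006, §2.4 (2.36)] -/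
theorem continuous_ppMidKernelS_value₂ {β Λ : ℝ} (hβ : 0 < β) {κ : ℝ → ℝ} (hκc : Continuous κ) {lo : ℝ} (hlo : 0 < lo) :
    Continuous fun p : ℝ × ℝ => ppMidKernelS β Λ κ lo p.1 p.2 := by
  unfold ppMidKernelS
  refine (continuous_ppTrueKernel_comp hβ Λ continuous_fst continuous_snd).mul ?_
  exact (continuous_const.sub (hκc.comp (continuous_ppSmoothRatio₂ hlo))).sub
    (hκc.comp (continuous_const.sub (continuous_ppSmoothRatio₂ hlo)))

section Bump

variable {β Λ : ℝ} (hβ : 0 < β) (hΛ : 0 < Λ) {B₁ B₂ B₃ : ℝ} (hB₁ : ∀ x, |deriv salmhoferCutoff x| ≤ B₁) (hB₂ : ∀ x, |deriv (deriv salmhoferCutoff) x| ≤ B₂)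
  (hB₃ : ∀ x, |deriv (deriv (deriv salmhoferCutoff)) x| ≤ B₃)
  {κ κ' κ'' : ℝ → ℝ} (hκ : ∀ t, HasDerivAt κ (κ' t) t) (hκ' : ∀ t, HasDerivAt κ' (κ'' t) t) (hκ''c : Continuous κ'')
  {κ₀ κ₁ κ₂ : ℝ} (hκb : ∀ t ∈ Icc 0 1, |κ t| ≤ κ₀) (hκ'b : ∀ t ∈ Icc 0 1, |κ' t| ≤ κ₁) (hκ''b : ∀ t ∈ Icc 0 1, |κ'' t| ≤ κ₂)
  {t₁ : ℝ} (ht₀ : 0 < t₁) (ht25 : t₁ ≤ 2 / 5)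
  (hκs : ∀ t, t₁ ≤ t → κ t = 0) (hκ's : ∀ t, t₁ ≤ t → κ' t = 0) (hκ''s : ∀ t, t₁ ≤ t → κ'' t = 0)
  (hκ1 : ∀ t, t ≤ t₁ / 2 → κ t = 1) (hκ'1 : ∀ t, t ≤ t₁ / 2 → κ' t = 0) (hκ''1 : ∀ t, t ≤ t₁ / 2 → κ'' t = 0)
  {lo hi C : ℝ} (hlo : 0 < lo) (hloΛ : lo ≤ Λ) (hC : 0 < C)
  {χ : ℝ → ℝ} (hχ : ContDiff ℝ 2 χ) {Bχ₁ Bχ₂ rχ Rχ Cχ : ℝ} (hχ0 : ∀ u, |χ u| ≤ 1) (hχ1 : ∀ u, |deriv χ u| ≤ Bχ₁)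
  (hχ2 : ∀ u, |deriv (deriv χ) u| ≤ Bχ₂) (hχ1r : ∀ u, |u| ≤ rχ → deriv χ u = 0) (hrχ : 0 < rχ) (hχ1z : ∀ u, Rχ ≤ |u| → deriv χ u = 0)
  (hχ2z : ∀ u, Rχ ≤ |u| → deriv (deriv χ) u = 0) (hhiR : hi ≤ Rχ) (hCχ : 1 + 2 * Bχ₁ * Rχ + Bχ₂ * Rχ ^ 2 ≤ Cχ)

set_option maxHeartbeats 800000 in
include hβ hΛ hB₁ hB₂ hB₃ hκ hκ' hκ''c hκb hκ'b hκ''b ht₀ ht25 hκs hκ's hκ''s hκ1 hκ'1 hκ''1 hlo hloΛ hC hχ hχ0 hχ1 hχ2 hχ1r hrχ hχ1z hχ2z hhiR hCχ in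
/-- **THE FIFTEEN KERNEL ROWS OF U7-MIDDLE FOR THE BUMPED COMPARABLE PIECE `χ(u)·(M_s(e,u)/C)/Cχ`** in the binder order and shapes of
`umkLoopCircle_integral_middle_le_canonical`; see the module docstring for the constants. [cite: BenfattoGiulianiMastropietro2006, §2.4 (2.36)] -/
theorem ppMidKernelSBump_lawRows (hC0 : (1 + 2 * κ₀) * (12 * B₁ + 9) ≤ C)
    (hC1 : (1 + 2 * κ₀) * (128 * B₂ + 216 * B₁ + 294 + (48 * B₁ + 28) * ((2 - t₁) / t₁)) + 2 * κ₁ * (12 * B₁ + 9) ≤ C)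
    (hC2 : (1 + 2 * κ₀) * (512 * B₃ + 1664 * B₂ + 5280 * B₁ + 3424 + (256 * B₂ + 384 * B₁ + 504) * ((2 - t₁) / t₁) ^ 2 + (192 * B₁ + 112) * ((2 - t₁) / t₁)) +
          4 * κ₁ * (128 * B₂ + 216 * B₁ + 294 + (48 * B₁ + 28) * ((2 - t₁) / t₁)) +
          (12 * B₁ + 9) * (2 * κ₂ + 2 * κ₁ * ((2 - t₁) / t₁ + 2)) ≤ C)
    (hCs : (1 + 2 * κ₀) * (128 * B₁ + 72) + 16 * κ₁ ≤ C) (hlohi : lo ≤ hi) {wt : ℝ → ℝ} {W W' : ℝ} (hwc : ContinuousOn wt (Icc (-hi) hi))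
    (hw0 : ∀ e ∈ Icc (-hi) hi, 0 ≤ wt e) (hwW : ∀ e ∈ Icc (-hi) hi, wt e ≤ W) (hW' : 0 ≤ W') (hwL : ∀ e ∈ Icc lo hi, |wt e - wt lo| ≤ W' * (e - lo)) :
    (∀ e ∈ Icc (-hi) hi, ContDiff ℝ 1 (fun v : ℝ => χ v * (ppMidKernelS β Λ κ lo e v / C) / Cχ)) ∧
    (∀ e ∈ Icc lo hi, ContDiff ℝ 2 (fun v : ℝ => χ v * (ppMidKernelS β Λ κ lo e v / C) / Cχ)) ∧
    (∀ e ∈ Icc (-hi) hi, e ≠ 0 → ∀ u, |χ u * (ppMidKernelS β Λ κ lo e u / C) / Cχ| ≤ (max |e| |u|)⁻¹) ∧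
    (∀ e ∈ Icc (-lo) lo, ∀ u, |χ u * (ppMidKernelS β Λ κ lo e u / C) / Cχ| ≤ (max lo |u|)⁻¹) ∧
    (∀ e ∈ Icc (-hi) hi, e ≠ 0 → ∀ u, |deriv (fun v : ℝ => χ v * (ppMidKernelS β Λ κ lo e v / C) / Cχ) u| ≤ (max |e| |u|)⁻¹ ^ 2) ∧
    (∀ e ∈ Icc lo hi, ∀ u, |iteratedDeriv 2 (fun v : ℝ => χ v * (ppMidKernelS β Λ κ lo e v / C) / Cχ) u| ≤ (max e |u|)⁻¹ ^ 3) ∧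
    (∀ e ∈ Icc lo hi, ∀ u, 2 * ((2 - t₁) / t₁) * e ≤ |u| → deriv (fun v : ℝ => χ v * (ppMidKernelS β Λ κ lo e v / C) / Cχ) u = 0) ∧
    (∀ e ∈ Icc lo hi, ∀ u, u ≤ -(e / 4) → |deriv (fun v : ℝ => χ v * (ppMidKernelS β Λ κ lo e v / C) / Cχ) u| ≤ (((8 * ((2 - t₁) / t₁) * (Λ / lo) * ((1 + 2 * κ₀) * (128 * B₂ + 216 * B₁ + 294 + (48 * B₁ + 28) * ((2 - t₁) / t₁)) + 2 * κ₁ * (12 * B₁ + 9)) +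
          ((1 + 2 * κ₀) * (48 * ((2 - t₁) / t₁) ^ 3) + 16 * κ₁ * ((2 - t₁) / t₁) ^ 2) / (β * lo)) / C) + Bχ₁ * Rχ * (Rχ / lo)) / Cχ * lo * (max e |u|)⁻¹ ^ 3) ∧
    (Continuous fun p : ℝ × ℝ => deriv (fun v : ℝ => χ v * (ppMidKernelS β Λ κ lo p.1 v / C) / Cχ) p.2) ∧
    (∀ D : ℝ, 0 < D → D ≤ hi / t₁ →
      |∫ e in (max lo (D / (2 * ((2 - t₁) / t₁) + 3 / 2)))..(min hi (4 * D)), wt e * deriv (fun v : ℝ => χ v * (ppMidKernelS β Λ κ lo e v / C) / Cχ) (D - e)| ≤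
        (W * (65 + 32 * ((2 - t₁) / t₁) * (Λ + lo) / lo + (12 * (1 + 2 * κ₀) / β + 4 * κ₁ * ((2 - t₁) / t₁) * lo + (1 + 2 * κ₀) * hi) / (C * lo))) / Cχ * (lo / (max D lo) ^ 2) + ((4 * (2 * ((2 - t₁) / t₁) + 3 / 2) * (W' + W * Bχ₁)) + W * Bχ₁ * rχ⁻¹ * hi) / Cχ) ∧
    (∀ s ∈ Icc lo hi, ∀ u, s / 2 ≤ u → |deriv (fun v : ℝ => χ v * (ppMidKernelS β Λ κ lo (-s) v / C) / Cχ) u| ≤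
      ((((64 * ((1 + 2 * κ₀) * (64 * B₂ + 120 * B₁ + 154) + (2 * κ₁) * (12 * B₁ + 9)) * Λ ^ 3 / (s + 2 * Λ) ^ 3 +
          ((1 + 2 * κ₀) * ((β * lo) ^ 2 + 2) + (2 * κ₁) * (β * lo + 1)) * Real.exp (-(β / 2 * s))) / C) + Bχ₁ * (Rχ ^ 2 / s)) / Cχ) * ((max (u - s) lo)⁻¹ ^ 2)) ∧
    (∀ s ∈ Icc lo hi, 0 ≤ ((((64 * ((1 + 2 * κ₀) * (64 * B₂ + 120 * B₁ + 154) + (2 * κ₁) * (12 * B₁ + 9)) * Λ ^ 3 / (s + 2 * Λ) ^ 3 +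
          ((1 + 2 * κ₀) * ((β * lo) ^ 2 + 2) + (2 * κ₁) * (β * lo + 1)) * Real.exp (-(β / 2 * s))) / C) + Bχ₁ * (Rχ ^ 2 / s)) / Cχ)) ∧
    (ContinuousOn (fun s : ℝ => ((((64 * ((1 + 2 * κ₀) * (64 * B₂ + 120 * B₁ + 154) + (2 * κ₁) * (12 * B₁ + 9)) * Λ ^ 3 / (s + 2 * Λ) ^ 3 +
          ((1 + 2 * κ₀) * ((β * lo) ^ 2 + 2) + (2 * κ₁) * (β * lo + 1)) * Real.exp (-(β / 2 * s))) / C) + Bχ₁ * (Rχ ^ 2 / s)) / Cχ)) (Icc lo hi)) ∧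
    (∀ a ∈ Icc lo hi, ∫ s in a..hi, ((((64 * ((1 + 2 * κ₀) * (64 * B₂ + 120 * B₁ + 154) + (2 * κ₁) * (12 * B₁ + 9)) * Λ ^ 3 / (s + 2 * Λ) ^ 3 +
          ((1 + 2 * κ₀) * ((β * lo) ^ 2 + 2) + (2 * κ₁) * (β * lo + 1)) * Real.exp (-(β / 2 * s))) / C) + Bχ₁ * (Rχ ^ 2 / s)) / Cχ) ≤ (((32 * ((1 + 2 * κ₀) * (64 * B₂ + 120 * B₁ + 154) + (2 * κ₁) * (12 * B₁ + 9)) * (Λ / lo) ^ 3 +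
          32 * ((1 + 2 * κ₀) * ((β * lo) ^ 2 + 2) + (2 * κ₁) * (β * lo + 1)) / (β * lo) ^ 3) / C) + Bχ₁ * (Rχ ^ 2 * hi ^ 2 / lo ^ 3)) / Cχ * (lo * (lo / a) ^ 2)) ∧
    (∀ e ∈ Icc (-lo) lo, ∀ u, |deriv (fun v : ℝ => χ v * (ppMidKernelS β Λ κ lo e v / C) / Cχ) u| ≤ (max lo |u|)⁻¹ ^ 2) := by
  have hB10 : 0 ≤ B₁ := salmhoferB₁_nonneg hB₁
  have hκ₀ : 0 ≤ κ₀ := (abs_nonneg _).trans (hκb 0 (left_mem_Icc.2 zero_le_one))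
  have hκc : Continuous κ := continuous_iff_continuousAt.2 fun t => (hκ t).continuousAt
  have hκ'c : Continuous κ' := continuous_iff_continuousAt.2 fun t => (hκ' t).continuousAt
  have hχd : Differentiable ℝ χ := hχ.differentiable (by norm_num)
  have hBχ1 : 0 ≤ Bχ₁ := (abs_nonneg _).trans (hχ1 0)
  have hC1χ : 1 ≤ Cχ := bumpNormalisation_one_le hχ1 hχ2 hlo hlohi hhiR hCχ
  have hCχ0 : 0 < Cχ := by linarith
  have hRχ0 : 0 < Rχ := hlo.trans_le (hlohi.trans hhiR)
  have hhi0 : 0 < hi := hlo.trans_le hlohi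
  have hsub : Icc lo hi ⊆ Icc (-hi) hi := Icc_subset_Icc (by linarith only [hlo, hlohi]) le_rfl
  have hwW' : ∀ e ∈ Icc (-hi) hi, |wt e| ≤ W := fun e he => by
    rw [abs_of_nonneg (hw0 e he)]; exact hwW e he
  have hwWlo : ∀ e ∈ Icc lo hi, |wt e| ≤ W := fun e he => hwW' e (hsub he)
  have hW0 : 0 ≤ W := (abs_nonneg _).trans (hwWlo lo (left_mem_Icc.2 hlohi))
  obtain ⟨rKd, rK2d, rK0, rK0s, rK1, rK2, rcomp, rKopp, rKc, -, rKn1, rρ0, rρc, rρtail, rKs1⟩ :=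
    ppMidKernelS_lawRows (hi := hi) hβ hΛ hB₁ hB₂ hB₃ hκ hκ' hκ''c hκb hκ'b hκ''b ht₀ ht25 hκs hκ's hκ''s hκ1 hκ'1 hκ''1 hlo hloΛ hC
      hC0 hC1 hC2 hCs hlohi hwc hw0 hwW hW' hwL
  obtain ⟨hqc, -⟩ := ppMidKernelS_lawConsts (hi := hi) hβ hΛ hB₁ hB₂ hκb hκ'b ht₀ ht25 hlo hC hW0 hW' hhi0
  have hKc0 : Continuous fun p : ℝ × ℝ => ppMidKernelS β Λ κ lo p.1 p.2 / C := (continuous_ppMidKernelS_value₂ hβ hκc hlo).div_const C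
  have hKdiff : ∀ e, Differentiable ℝ (fun v : ℝ => ppMidKernelS β Λ κ lo e v / C) := fun e =>
    ((contDiff_two_ppMidKernelS_u hβ hΛ hB₁ hB₂ hκ hκ' hκ''c hlo e).div_const C).differentiable (by norm_num)
  -- value vanishing beyond the comparable zone (for `hcomp`)
  have hcomp0 : ∀ e ∈ Icc lo hi, ∀ u, 2 * ((2 - t₁) / t₁) * e ≤ |u| → ppMidKernelS β Λ κ lo e u / C = 0 := fun e he u hu => by
    rw [ppMidKernelS_eq_zero_of_ge ht₀ ht25 hκs hκ's hκ1 hκ'1 hlo he.1 hu, zero_div]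
  -- value row on the bump's transition zone at opposite sign (for `hKopp`): from hK0, `Cv := Rχ/lo`
  have hKopp0 : ∀ e ∈ Icc lo hi, ∀ u, u ≤ -(e / 4) → |u| < Rχ → |ppMidKernelS β Λ κ lo e u / C| ≤ Rχ / lo * lo * (max e |u|)⁻¹ ^ 2 :=
    fun e he u _ huR => by
    have he0 : 0 < e := hlo.trans_le he.1
    have h := rK0 e (hsub he) he0.ne' u
    rw [abs_of_pos he0] at h
    have hm0 : 0 < max e |u| := lt_max_of_lt_left he0
    have hmR : max e |u| ≤ Rχ := max_le (he.2.trans hhiR) huR.le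
    have hconv := inv_le_mul_inv_sq hm0 hmR
    calc |ppMidKernelS β Λ κ lo e u / C| ≤ (max e |u|)⁻¹ := h
      _ ≤ Rχ * (max e |u|)⁻¹ ^ 2 := hconv
      _ = Rχ / lo * lo * (max e |u|)⁻¹ ^ 2 := by field_simp
  -- band flatness at the modified weights `wt·χ(D−·)`
  have rflatBχ : ∀ D : ℝ, 0 < D → D ≤ hi / t₁ →
      |∫ e in (max lo (D / (2 * ((2 - t₁) / t₁) + 3 / 2)))..(min hi (4 * D)), (wt e * χ (D - e)) * deriv (fun v : ℝ => ppMidKernelS β Λ κ lo e v / C) (D - e)| ≤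
        (W * (65 + 32 * ((2 - t₁) / t₁) * (Λ + lo) / lo + (12 * (1 + 2 * κ₀) / β + 4 * κ₁ * ((2 - t₁) / t₁) * lo + (1 + 2 * κ₀) * hi) / (C * lo))) * (lo / (max D lo) ^ 2) + (4 * (2 * ((2 - t₁) / t₁) + 3 / 2) * (W' + W * Bχ₁)) := fun D hD hDle => by
    have hwcD : ContinuousOn (fun e => wt e * χ (D - e)) (Icc (-hi) hi) :=
      hwc.mul ((hχ.continuous.comp (continuous_const.sub continuous_id)).continuousOn)
    have hwWD : ∀ e ∈ Icc (-hi) hi, |wt e * χ (D - e)| ≤ W := fun e he => by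
      rw [abs_mul]
      calc |wt e| * |χ (D - e)| ≤ W * 1 := mul_le_mul (hwW' e he) (hχ0 _) (abs_nonneg _) hW0
        _ = W := mul_one W
    have hwLD := lipschitzAnchor_mul_bump (lo := lo) (hi := hi) hχd hχ0 hχ1 hwWlo hW' hwL hlohi D
    have hW'' : 0 ≤ W' + W * Bχ₁ := by positivity
    exact midS_hflatB_row hβ hΛ hB₁ hB₂ hκ hκ'c hκb hκ'b ht₀ ht25 hκs hκ's hκ1 hκ'1 hlo hloΛ hC hC1 hCs hlohi hwcD hwWD hW'' hwLD hD hDle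
  have hDfl' : hi / t₁ ≤ (2 * ((2 - t₁) / t₁) + 3 / 2) * hi := by
    rw [div_le_iff₀ ht₀]
    have h1 : 2 * ((2 - t₁) / t₁) * t₁ = 2 * (2 - t₁) := by field_simp
    nlinarith [h1, hhi0.le, ht25, ht₀]
  have H_flatB := bumpKernel_hflatB (C := Cχ) hχ hχ1 hχ1r hrχ hlo hlohi hC1χ hqc rKd hKc0 rKc rK0 hwc hwW' hDfl' rflatBχ
  -- negative levels
  have hKv : ∀ s ∈ Icc lo hi, ∀ u, |ppMidKernelS β Λ κ lo (-s) u / C| ≤ s⁻¹ := fun s hs u => by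
    have hs0 : 0 < s := hlo.trans_le hs.1
    have h := rK0 (-s) ⟨by linarith [hs.2], by linarith [hs.1, hlo]⟩ (by linarith) u
    rw [abs_neg, abs_of_pos hs0] at h
    exact h.trans (inv_anti₀ hs0 (le_max_left _ _))
  have H_Kn1 := bumpKernel_hKn1_cutoff (Cχ := Cχ) hχ hχ0 hχ1 hχ1r hχ1z hlo hlohi hhiR hC1χ hKdiff rKn1 hKv
  obtain ⟨hv0, hvc, hvtail⟩ := bump_ρv_rows (Rχ := Rχ) hlo hlohi
  obtain ⟨H_ρ0, H_ρc, H_ρtail⟩ := bumpKernel_hρ (C := Cχ) hBχ1 hCχ0 rρ0 rρc rρtail hv0 hvc hvtail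
  have H_Kopp := bumpKernel_hKopp (C := Cχ) hχ hχ0 hχ1 hχ1z hlo hlohi hhiR hC1χ (by positivity : (0 : ℝ) ≤ Rχ / lo) rKd rKopp hKopp0
  refine ⟨bumpKernel_hKd (C := Cχ) hχ rKd, bumpKernel_hK2d (C := Cχ) hχ rK2d,
    bumpKernel_hK0 hχ0 hχ1 hχ2 hlo hlohi hhiR hCχ rK0, bumpKernel_hK0s hχ0 hχ1 hχ2 hlo hlohi hhiR hCχ rK0s,
    bumpKernel_hK1 hχ hχ0 hχ1 hχ2 hχ1z hlo hlohi hhiR hCχ rKd rK0 rK1,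
    bumpKernel_hK2 hχ hχ0 hχ1 hχ2 hχ1z hχ2z hlo hlohi hhiR hCχ rK2d rK0 rK1 rK2,
    bumpKernel_hcomp (C := Cχ) hχ rKd hcomp0 rcomp hlo, ?_, bumpKernel_hKc (C := Cχ) hχ hKdiff hKc0 rKc,
    H_flatB, H_Kn1, H_ρ0, H_ρc, H_ρtail,
    bumpKernel_hKs1 hχ hχ0 hχ1 hχ2 hχ1z hlo hlohi hhiR hCχ rKd rK0s rKs1⟩
  intro e he u hu
  refine (H_Kopp e he u hu).trans (le_of_eq ?_)
  ring

set_option maxHeartbeats 400000 in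
include hβ hΛ hB₁ hB₂ hκ hκ' hκ''c hκb hκ'b ht₀ ht25 hκs hκ's hκ1 hκ'1 hlo hloΛ hC hχ hχ0 hχ1 hχ2 hχ1z hhiR hCχ in
/-- **THE SIX ROWS OF B-1 (vi) FOR THE BUMPED COMPARABLE PIECE** `χ(u)·(M_s(e,u)/C)/Cχ`: `ppMidKernelS_firstOrderRows` ∘ `bumpKernel_*`. [cite: BenfattoGiulianiMastropietro2006, §2.4 (2.36)] -/
theorem ppMidKernelSBump_firstOrderRows (hC0 : (1 + 2 * κ₀) * (12 * B₁ + 9) ≤ C)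
    (hC1 : (1 + 2 * κ₀) * (128 * B₂ + 216 * B₁ + 294 + (48 * B₁ + 28) * ((2 - t₁) / t₁)) + 2 * κ₁ * (12 * B₁ + 9) ≤ C)
    (hCs : (1 + 2 * κ₀) * (128 * B₁ + 72) + 16 * κ₁ ≤ C) (hlohi : lo ≤ hi) :
    (∀ e ∈ Icc (-hi) hi, ContDiff ℝ 1 (fun v : ℝ => χ v * (ppMidKernelS β Λ κ lo e v / C) / Cχ)) ∧
    (Continuous fun p : ℝ × ℝ => deriv (fun v : ℝ => χ v * (ppMidKernelS β Λ κ lo p.1 v / C) / Cχ) p.2) ∧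
    (∀ e ∈ Icc (-hi) hi, e ≠ 0 → ∀ u, |χ u * (ppMidKernelS β Λ κ lo e u / C) / Cχ| ≤ (max |e| |u|)⁻¹) ∧
    (∀ e ∈ Icc (-lo) lo, ∀ u, |χ u * (ppMidKernelS β Λ κ lo e u / C) / Cχ| ≤ (max lo |u|)⁻¹) ∧
    (∀ e ∈ Icc (-hi) hi, e ≠ 0 → ∀ u, |deriv (fun v : ℝ => χ v * (ppMidKernelS β Λ κ lo e v / C) / Cχ) u| ≤ (max |e| |u|)⁻¹ ^ 2) ∧
    (∀ e ∈ Icc (-lo) lo, ∀ u, |deriv (fun v : ℝ => χ v * (ppMidKernelS β Λ κ lo e v / C) / Cχ) u| ≤ (max lo |u|)⁻¹ ^ 2) := by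
  have hκc : Continuous κ := continuous_iff_continuousAt.2 fun t => (hκ t).continuousAt
  obtain ⟨rKd, rKc, rK0, rK0s, rK1, rKs1⟩ :=
    ppMidKernelS_firstOrderRows (hi := hi) hβ hΛ hB₁ hB₂ hκ hκ' hκ''c hκb hκ'b ht₀ ht25 hκs hκ's hκ1 hκ'1 hlo hloΛ hC hC0 hC1 hCs
  have hKc0 : Continuous fun p : ℝ × ℝ => ppMidKernelS β Λ κ lo p.1 p.2 / C := (continuous_ppMidKernelS_value₂ hβ hκc hlo).div_const C
  have hKdiff : ∀ e, Differentiable ℝ (fun v : ℝ => ppMidKernelS β Λ κ lo e v / C) := fun e =>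
    ((contDiff_two_ppMidKernelS_u hβ hΛ hB₁ hB₂ hκ hκ' hκ''c hlo e).div_const C).differentiable (by norm_num)
  exact ⟨bumpKernel_hKd (C := Cχ) hχ rKd, bumpKernel_hKc (C := Cχ) hχ hKdiff hKc0 rKc,
    bumpKernel_hK0 hχ0 hχ1 hχ2 hlo hlohi hhiR hCχ rK0, bumpKernel_hK0s hχ0 hχ1 hχ2 hlo hlohi hhiR hCχ rK0s,
    bumpKernel_hK1 hχ hχ0 hχ1 hχ2 hχ1z hlo hlohi hhiR hCχ rKd rK0 rK1,
    bumpKernel_hKs1 hχ hχ0 hχ1 hχ2 hχ1z hlo hlohi hhiR hCχ rKd rK0s rKs1⟩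

end Bump

end Summit.HubbardSuperconductivity.HubbardSuperconductivity.Theorems.C4a

end
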